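import Summits.CriticalPhenomena.PercolationContinuityZ3.Theorems.PercNearOneGluingNoHeavyLowerTailOneSumFreeGlue
import Summits.CriticalPhenomena.PercolationContinuityZ3.Theorems.PercNearOneGluingNoHeavyLowerTailApexTwoSum
import HarnessLib

/-!
# `NoHeavyLowerTail` (stmt-CriticalPhenomena-4575) — 1-SUMS, TERMINAL-FREE BLOCKS, MEASURE LEVEL (every `q > 0`):
# deleting a terminal-free block hanging at a cut vertex does not affect R1

Support file (prover prim-gen-kcluster gen 72; `--supports stmt-CriticalPhenomena-4575`).  No definitions, no named facts, no sorries.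
SETTING as in `…OneSumFreeGlue`: supports `DX`, `DY` meeting only in `u`; `a, b, c` on no pair of `DX` unless equal to `u`; `w` vanishing off
`DX ∪ DY`, `wX = w·1_{DX}`, `wY = w·1_{DXᶜ}`.  Each R1 cell of `(a; b, c)` is the same event for `ω` and for its `Y`-block (part 1), so
`Zφ(cell) · q^{k(∅)} = M_X · R_Y(cell)` with `M_X` the TOTAL mass of the block, and

**THEOREM** (`OneSumFree.r1_of_freeBlock`): R1 for `(a; b, c)` on `rcMeasureW wY q ∅` (support `DY`) implies R1 for `(a; b, c)` on `rcMeasureW w q ∅`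
(support `D = DX ∪ DY`).  With `OneSumApex.r1_of_apexBlock` (apex block) and `ApexTwoSum.r1_of_pendant` (terminal block) this covers every
cut vertex: a minimal counterexample to R1-RC(q ≥ 1) is 2-connected (gen 57 §3.2, kernel modulo landing).
-/

noncomputable section

namespace Summit.CriticalPhenomena.PercolationContinuityZ3.Theorems

namespace OneSumFree

open Finset SimpleGraph Literature.Probability.Percolation Literature.Probability.Percolation.Gladkov
open Literature.Probability.Percolation.BHK2006 (weight)
open Literature.Probability.Percolation.DecisionTree (ind ind_of_mem ind_of_not_mem ind_nonneg)
open Literature.Probability.LatticeModels RefinedRowR3 ThreePointLB MeasureTheory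
open scoped Classical

variable {V : Type*} [Fintype V]

section Pointwise

variable {DX DY : Finset (Sym2 V)} {a b c u : V}
  (hsepD : ∀ x : V, (∃ e ∈ DX, x ∈ e) → (∃ e ∈ DY, x ∈ e) → (x = u ∨ x = u))
  (ha : ∀ e ∈ DX, a ∈ e → a = u) (hb : ∀ e ∈ DX, b ∈ e → b = u) (hc : ∀ e ∈ DX, c ∈ e → c = u)
  (w : Sym2 V → unitInterval) (q : ℝ) (hw : ∀ e, e ∉ (↑DX ∪ ↑DY : Set (Sym2 V)) → (w e : ℝ) = 0)
include hsepD ha hb hc hw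

/-- **Pointwise, cell `T`**: the glued cell is the `Y`-block's cell. [this work] -/
theorem pt_T (ω : BondConfig V) :
    rcWeightW w q ∅ ω * ind {η : BondConfig V | b ∈ cl η.toFinset a ∧ c ∈ cl η.toFinset a} ω * q ^ clusterCount (∅ : BondConfig V) ({u, u} : Set V) =
      weight (fun e => (w e : ℝ)) ω * ((ind (Set.univ : Set (BondConfig V)) (ω ∩ ↑DX) * q ^ clusterCount (ω ∩ ↑DX) ({u, u} : Set V)) * (ind {η : BondConfig V | b ∈ cl η.toFinset a ∧ c ∈ cl η.toFinset a} (ω \ ↑DX) * q ^ clusterCount (ω \ ↑DX) ({u, u} : Set V))) := by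
  by_cases hω : ω ⊆ ↑DX ∪ ↑DY
  swap
  · obtain ⟨e, heω, heD⟩ := Set.not_subset.1 hω
    have h0 := ApexTwoSum.weight_eq_zero_of_mem_not_mem w hw heω heD
    unfold rcWeightW
    rw [h0]; ring
  have jb := glued_mem_iff hsepD ha hb hω
  have jc := glued_mem_iff hsepD ha hc hω
  have hadd := ApexTwoSum.kT_add hsepD hω
  have hk : clusterCount ω ∅ = clusterCount ω ({u, u} : Set V) := (OneSumApex.clusterCount_pair_self u ω).symm
  have hpow : q ^ clusterCount ω ∅ * q ^ clusterCount (∅ : BondConfig V) ({u, u} : Set V) = q ^ clusterCount (ω ∩ ↑DX) ({u, u} : Set V) * q ^ clusterCount (ω \ ↑DX) ({u, u} : Set V) := by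
    rw [← pow_add, hk, hadd, pow_add]
  have hiff : ω ∈ {η : BondConfig V | b ∈ cl η.toFinset a ∧ c ∈ cl η.toFinset a} ↔ (ω \ ↑DX) ∈ {η : BondConfig V | b ∈ cl η.toFinset a ∧ c ∈ cl η.toFinset a} := by
    simp only [Set.mem_setOf_eq]; rw [jb, jc]; simp only [Set.mem_setOf_eq]
  rw [ind_of_mem (Set.mem_univ _)]
  by_cases hy : (ω \ ↑DX) ∈ {η : BondConfig V | b ∈ cl η.toFinset a ∧ c ∈ cl η.toFinset a}
  · rw [ind_of_mem hy, ind_of_mem (hiff.2 hy)]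
    unfold rcWeightW
    linear_combination (weight (fun e => (w e : ℝ)) ω) * hpow
  · rw [ind_of_not_mem hy, ind_of_not_mem (fun h => hy (hiff.1 h))]
    ring

/-- **Pointwise, cell `U_b`.** [this work] -/
theorem pt_Ub (ω : BondConfig V) :
    rcWeightW w q ∅ ω * ind {η : BondConfig V | b ∈ cl η.toFinset a ∧ c ∉ cl η.toFinset a} ω * q ^ clusterCount (∅ : BondConfig V) ({u, u} : Set V) =
      weight (fun e => (w e : ℝ)) ω * ((ind (Set.univ : Set (BondConfig V)) (ω ∩ ↑DX) * q ^ clusterCount (ω ∩ ↑DX) ({u, u} : Set V)) * (ind {η : BondConfig V | b ∈ cl η.toFinset a ∧ c ∉ cl η.toFinset a} (ω \ ↑DX) * q ^ clusterCount (ω \ ↑DX) ({u, u} : Set V))) := by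
  by_cases hω : ω ⊆ ↑DX ∪ ↑DY
  swap
  · obtain ⟨e, heω, heD⟩ := Set.not_subset.1 hω
    have h0 := ApexTwoSum.weight_eq_zero_of_mem_not_mem w hw heω heD
    unfold rcWeightW
    rw [h0]; ring
  have jb := glued_mem_iff hsepD ha hb hω
  have jc := glued_mem_iff hsepD ha hc hω
  have hadd := ApexTwoSum.kT_add hsepD hω
  have hk : clusterCount ω ∅ = clusterCount ω ({u, u} : Set V) := (OneSumApex.clusterCount_pair_self u ω).symm
  have hpow : q ^ clusterCount ω ∅ * q ^ clusterCount (∅ : BondConfig V) ({u, u} : Set V) = q ^ clusterCount (ω ∩ ↑DX) ({u, u} : Set V) * q ^ clusterCount (ω \ ↑DX) ({u, u} : Set V) := by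
    rw [← pow_add, hk, hadd, pow_add]
  have hiff : ω ∈ {η : BondConfig V | b ∈ cl η.toFinset a ∧ c ∉ cl η.toFinset a} ↔ (ω \ ↑DX) ∈ {η : BondConfig V | b ∈ cl η.toFinset a ∧ c ∉ cl η.toFinset a} := by
    simp only [Set.mem_setOf_eq]; rw [jb, jc]; simp only [Set.mem_setOf_eq]
  rw [ind_of_mem (Set.mem_univ _)]
  by_cases hy : (ω \ ↑DX) ∈ {η : BondConfig V | b ∈ cl η.toFinset a ∧ c ∉ cl η.toFinset a}
  · rw [ind_of_mem hy, ind_of_mem (hiff.2 hy)]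
    unfold rcWeightW
    linear_combination (weight (fun e => (w e : ℝ)) ω) * hpow
  · rw [ind_of_not_mem hy, ind_of_not_mem (fun h => hy (hiff.1 h))]
    ring

/-- **Pointwise, cell `U_c`.** [this work] -/
theorem pt_Uc (ω : BondConfig V) :
    rcWeightW w q ∅ ω * ind {η : BondConfig V | b ∉ cl η.toFinset a ∧ c ∈ cl η.toFinset a} ω * q ^ clusterCount (∅ : BondConfig V) ({u, u} : Set V) =
      weight (fun e => (w e : ℝ)) ω * ((ind (Set.univ : Set (BondConfig V)) (ω ∩ ↑DX) * q ^ clusterCount (ω ∩ ↑DX) ({u, u} : Set V)) * (ind {η : BondConfig V | b ∉ cl η.toFinset a ∧ c ∈ cl η.toFinset a} (ω \ ↑DX) * q ^ clusterCount (ω \ ↑DX) ({u, u} : Set V))) := by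
  by_cases hω : ω ⊆ ↑DX ∪ ↑DY
  swap
  · obtain ⟨e, heω, heD⟩ := Set.not_subset.1 hω
    have h0 := ApexTwoSum.weight_eq_zero_of_mem_not_mem w hw heω heD
    unfold rcWeightW
    rw [h0]; ring
  have jb := glued_mem_iff hsepD ha hb hω
  have jc := glued_mem_iff hsepD ha hc hω
  have hadd := ApexTwoSum.kT_add hsepD hω
  have hk : clusterCount ω ∅ = clusterCount ω ({u, u} : Set V) := (OneSumApex.clusterCount_pair_self u ω).symm
  have hpow : q ^ clusterCount ω ∅ * q ^ clusterCount (∅ : BondConfig V) ({u, u} : Set V) = q ^ clusterCount (ω ∩ ↑DX) ({u, u} : Set V) * q ^ clusterCount (ω \ ↑DX) ({u, u} : Set V) := by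
    rw [← pow_add, hk, hadd, pow_add]
  have hiff : ω ∈ {η : BondConfig V | b ∉ cl η.toFinset a ∧ c ∈ cl η.toFinset a} ↔ (ω \ ↑DX) ∈ {η : BondConfig V | b ∉ cl η.toFinset a ∧ c ∈ cl η.toFinset a} := by
    simp only [Set.mem_setOf_eq]; rw [jb, jc]; simp only [Set.mem_setOf_eq]
  rw [ind_of_mem (Set.mem_univ _)]
  by_cases hy : (ω \ ↑DX) ∈ {η : BondConfig V | b ∉ cl η.toFinset a ∧ c ∈ cl η.toFinset a}
  · rw [ind_of_mem hy, ind_of_mem (hiff.2 hy)]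
    unfold rcWeightW
    linear_combination (weight (fun e => (w e : ℝ)) ω) * hpow
  · rw [ind_of_not_mem hy, ind_of_not_mem (fun h => hy (hiff.1 h))]
    ring

/-- **Pointwise, separating cell.** [this work] -/
theorem pt_S (ω : BondConfig V) :
    rcWeightW w q ∅ ω * ind {η : BondConfig V | b ∉ cl η.toFinset a ∧ c ∉ cl η.toFinset a ∧ Sep (DX ∪ DY) (cl η.toFinset a) b c} ω * q ^ clusterCount (∅ : BondConfig V) ({u, u} : Set V) =
      weight (fun e => (w e : ℝ)) ω * ((ind (Set.univ : Set (BondConfig V)) (ω ∩ ↑DX) * q ^ clusterCount (ω ∩ ↑DX) ({u, u} : Set V)) * (ind {η : BondConfig V | b ∉ cl η.toFinset a ∧ c ∉ cl η.toFinset a ∧ Sep DY (cl η.toFinset a) b c} (ω \ ↑DX) * q ^ clusterCount (ω \ ↑DX) ({u, u} : Set V))) := by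
  by_cases hω : ω ⊆ ↑DX ∪ ↑DY
  swap
  · obtain ⟨e, heω, heD⟩ := Set.not_subset.1 hω
    have h0 := ApexTwoSum.weight_eq_zero_of_mem_not_mem w hw heω heD
    unfold rcWeightW
    rw [h0]; ring
  have jb := glued_mem_iff hsepD ha hb hω
  have jc := glued_mem_iff hsepD ha hc hω
  have hadd := ApexTwoSum.kT_add hsepD hω
  have hk : clusterCount ω ∅ = clusterCount ω ({u, u} : Set V) := (OneSumApex.clusterCount_pair_self u ω).symm
  have hpow : q ^ clusterCount ω ∅ * q ^ clusterCount (∅ : BondConfig V) ({u, u} : Set V) = q ^ clusterCount (ω ∩ ↑DX) ({u, u} : Set V) * q ^ clusterCount (ω \ ↑DX) ({u, u} : Set V) := by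
    rw [← pow_add, hk, hadd, pow_add]
  have hiff : ω ∈ {η : BondConfig V | b ∉ cl η.toFinset a ∧ c ∉ cl η.toFinset a ∧ Sep (DX ∪ DY) (cl η.toFinset a) b c} ↔ (ω \ ↑DX) ∈ {η : BondConfig V | b ∉ cl η.toFinset a ∧ c ∉ cl η.toFinset a ∧ Sep DY (cl η.toFinset a) b c} := by
    have js := sep_iff hsepD ha hb hc hω
    simp only [Set.mem_setOf_eq] at js ⊢; rw [jb, jc, js]; simp only [Set.mem_setOf_eq]
  rw [ind_of_mem (Set.mem_univ _)]
  by_cases hy : (ω \ ↑DX) ∈ {η : BondConfig V | b ∉ cl η.toFinset a ∧ c ∉ cl η.toFinset a ∧ Sep DY (cl η.toFinset a) b c}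
  · rw [ind_of_mem hy, ind_of_mem (hiff.2 hy)]
    unfold rcWeightW
    linear_combination (weight (fun e => (w e : ℝ)) ω) * hpow
  · rw [ind_of_not_mem hy, ind_of_not_mem (fun h => hy (hiff.1 h))]
    ring

end Pointwise

section Main

variable {DX DY D : Finset (Sym2 V)} {a b c u : V}
  (hsepD : ∀ x : V, (∃ e ∈ DX, x ∈ e) → (∃ e ∈ DY, x ∈ e) → (x = u ∨ x = u))
  (ha : ∀ e ∈ DX, a ∈ e → a = u) (hb : ∀ e ∈ DX, b ∈ e → b = u) (hc : ∀ e ∈ DX, c ∈ e → c = u)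
  (hD : ∀ e, e ∈ D ↔ e ∈ DX ∨ e ∈ DY)
  (w wX wY : Sym2 V → unitInterval) {q : ℝ} (hq : 0 < q)
  (hw : ∀ e, e ∉ (↑DX ∪ ↑DY : Set (Sym2 V)) → (w e : ℝ) = 0)
  (hX : ∀ e ∈ (↑DX : Set (Sym2 V)), wX e = w e) (hX' : ∀ e ∉ (↑DX : Set (Sym2 V)), wX e = 0)
  (hY : ∀ e ∈ (↑DX : Set (Sym2 V)), wY e = 0) (hY' : ∀ e ∉ (↑DX : Set (Sym2 V)), wY e = w e)
include hsepD ha hb hc hw hX hX' hY hY'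

/-- **Dictionary, cell `T`**: `K·Zφ(T) = M_X · R_Y(T)`. [this work] -/
theorem glued_T_sum :
    (∑ ω : BondConfig V, rcWeightW w q ∅ ω * ind {η : BondConfig V | b ∈ cl η.toFinset a ∧ c ∈ cl η.toFinset a} ω) * q ^ clusterCount (∅ : BondConfig V) ({u, u} : Set V) = (∑ η : BondConfig V, rcWeightW wX q ({u, u} : Set V) η * ind (Set.univ : Set (BondConfig V)) η) * (∑ η : BondConfig V, rcWeightW wY q ({u, u} : Set V) η * ind {η : BondConfig V | b ∈ cl η.toFinset a ∧ c ∈ cl η.toFinset a} η) := by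
  rw [Finset.sum_mul, Finset.sum_congr rfl fun ω _ => pt_T hsepD ha hb hc w q hw ω]
  have e1 := ApexTwoSum.sum_weight_blocks_rc w wX wY (↑DX) hX hX' hY hY' q ({u, u} : Set V) (fun x => ind (Set.univ : Set (BondConfig V)) x) (fun y => ind {η : BondConfig V | b ∈ cl η.toFinset a ∧ c ∈ cl η.toFinset a} y)
  beta_reduce at e1
  rw [← e1]

/-- **Dictionary, cell `U_b`.** [this work] -/
theorem glued_Ub_sum :
    (∑ ω : BondConfig V, rcWeightW w q ∅ ω * ind {η : BondConfig V | b ∈ cl η.toFinset a ∧ c ∉ cl η.toFinset a} ω) * q ^ clusterCount (∅ : BondConfig V) ({u, u} : Set V) = (∑ η : BondConfig V, rcWeightW wX q ({u, u} : Set V) η * ind (Set.univ : Set (BondConfig V)) η) * (∑ η : BondConfig V, rcWeightW wY q ({u, u} : Set V) η * ind {η : BondConfig V | b ∈ cl η.toFinset a ∧ c ∉ cl η.toFinset a} η) := by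
  rw [Finset.sum_mul, Finset.sum_congr rfl fun ω _ => pt_Ub hsepD ha hb hc w q hw ω]
  have e1 := ApexTwoSum.sum_weight_blocks_rc w wX wY (↑DX) hX hX' hY hY' q ({u, u} : Set V) (fun x => ind (Set.univ : Set (BondConfig V)) x) (fun y => ind {η : BondConfig V | b ∈ cl η.toFinset a ∧ c ∉ cl η.toFinset a} y)
  beta_reduce at e1
  rw [← e1]

/-- **Dictionary, cell `U_c`.** [this work] -/
theorem glued_Uc_sum :
    (∑ ω : BondConfig V, rcWeightW w q ∅ ω * ind {η : BondConfig V | b ∉ cl η.toFinset a ∧ c ∈ cl η.toFinset a} ω) * q ^ clusterCount (∅ : BondConfig V) ({u, u} : Set V) = (∑ η : BondConfig V, rcWeightW wX q ({u, u} : Set V) η * ind (Set.univ : Set (BondConfig V)) η) * (∑ η : BondConfig V, rcWeightW wY q ({u, u} : Set V) η * ind {η : BondConfig V | b ∉ cl η.toFinset a ∧ c ∈ cl η.toFinset a} η) := by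
  rw [Finset.sum_mul, Finset.sum_congr rfl fun ω _ => pt_Uc hsepD ha hb hc w q hw ω]
  have e1 := ApexTwoSum.sum_weight_blocks_rc w wX wY (↑DX) hX hX' hY hY' q ({u, u} : Set V) (fun x => ind (Set.univ : Set (BondConfig V)) x) (fun y => ind {η : BondConfig V | b ∉ cl η.toFinset a ∧ c ∈ cl η.toFinset a} y)
  beta_reduce at e1
  rw [← e1]

/-- **Dictionary, separating cell.** [this work] -/
theorem glued_S_sum :
    (∑ ω : BondConfig V, rcWeightW w q ∅ ω * ind {η : BondConfig V | b ∉ cl η.toFinset a ∧ c ∉ cl η.toFinset a ∧ Sep (DX ∪ DY) (cl η.toFinset a) b c} ω) * q ^ clusterCount (∅ : BondConfig V) ({u, u} : Set V) = (∑ η : BondConfig V, rcWeightW wX q ({u, u} : Set V) η * ind (Set.univ : Set (BondConfig V)) η) * (∑ η : BondConfig V, rcWeightW wY q ({u, u} : Set V) η * ind {η : BondConfig V | b ∉ cl η.toFinset a ∧ c ∉ cl η.toFinset a ∧ Sep DY (cl η.toFinset a) b c} η) := by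
  rw [Finset.sum_mul, Finset.sum_congr rfl fun ω _ => pt_S hsepD ha hb hc w q hw ω]
  have e1 := ApexTwoSum.sum_weight_blocks_rc w wX wY (↑DX) hX hX' hY hY' q ({u, u} : Set V) (fun x => ind (Set.univ : Set (BondConfig V)) x) (fun y => ind {η : BondConfig V | b ∉ cl η.toFinset a ∧ c ∉ cl η.toFinset a ∧ Sep DY (cl η.toFinset a) b c} y)
  beta_reduce at e1
  rw [← e1]

include hD hq in
/-- **Terminal-free blocks are irrelevant for R1** (every `q > 0`; see the module docstring). [this work] -/
theorem r1_of_freeBlock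
    (hR1Y : (rcMeasureW wY q ∅).real {η : BondConfig V | b ∈ cl η.toFinset a ∧ c ∈ cl η.toFinset a} * (rcMeasureW wY q ∅).real {η : BondConfig V | b ∉ cl η.toFinset a ∧ c ∉ cl η.toFinset a ∧ Sep DY (cl η.toFinset a) b c} ≤ (rcMeasureW wY q ∅).real {η : BondConfig V | b ∈ cl η.toFinset a ∧ c ∉ cl η.toFinset a} * (rcMeasureW wY q ∅).real {η : BondConfig V | b ∉ cl η.toFinset a ∧ c ∈ cl η.toFinset a}) :
    (rcMeasureW w q ∅).real {η : BondConfig V | b ∈ cl η.toFinset a ∧ c ∈ cl η.toFinset a} * (rcMeasureW w q ∅).real {η : BondConfig V | b ∉ cl η.toFinset a ∧ c ∉ cl η.toFinset a ∧ Sep D (cl η.toFinset a) b c} ≤ (rcMeasureW w q ∅).real {η : BondConfig V | b ∈ cl η.toFinset a ∧ c ∉ cl η.toFinset a} * (rcMeasureW w q ∅).real {η : BondConfig V | b ∉ cl η.toFinset a ∧ c ∈ cl η.toFinset a} := by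
  have hDD : D = DX ∪ DY := by ext e; rw [Finset.mem_union]; exact hD e
  subst hDD
  have hZ := rcPartitionFunctionW_pos w hq (∅ : Set V)
  have hZY := rcPartitionFunctionW_pos wY hq (∅ : Set V)
  have hK : 0 < q ^ clusterCount (∅ : BondConfig V) ({u, u} : Set V) := pow_pos hq _
  have hnn : ∀ (u' : Sym2 V → unitInterval) (E : Set (BondConfig V)),
      0 ≤ ∑ η : BondConfig V, rcWeightW u' q ({u, u} : Set V) η * ind E η := fun u' E =>
    Finset.sum_nonneg fun η _ => mul_nonneg (rcWeightW_nonneg u' hq.le _ η) (ind_nonneg E η)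
  have hfree : ∀ (E : Set (BondConfig V)), ∑ η : BondConfig V, rcWeightW wY q ∅ η * ind E η =
      ∑ η : BondConfig V, rcWeightW wY q ({u, u} : Set V) η * ind E η := fun E =>
    Finset.sum_congr rfl fun η _ => by unfold rcWeightW; rw [OneSumApex.clusterCount_pair_self]
  simp only [rcMeasureW_real_eq_sum_div w hq, rcMeasureW_real_eq_sum_div wY hq] at hR1Y ⊢
  rw [hfree, hfree, hfree, hfree] at hR1Y
  rw [div_mul_div_comm, div_mul_div_comm]
  refine div_le_div_of_nonneg_right ?_ (mul_pos hZ hZ).le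
  refine le_of_mul_le_mul_right (a := q ^ clusterCount (∅ : BondConfig V) ({u, u} : Set V) * q ^ clusterCount (∅ : BondConfig V) ({u, u} : Set V)) ?_ (mul_pos hK hK)
  have eT := glued_T_sum (q := q) hsepD ha hb hc w wX wY hw hX hX' hY hY'
  have eS := glued_S_sum (q := q) hsepD ha hb hc w wX wY hw hX hX' hY hY'
  have eUb := glued_Ub_sum (q := q) hsepD ha hb hc w wX wY hw hX hX' hY hY'
  have eUc := glued_Uc_sum (q := q) hsepD ha hb hc w wX wY hw hX hX' hY hY'
  rw [show ∀ x y K : ℝ, x * y * (K * K) = (x * K) * (y * K) from fun x y K => by ring, eT, eS,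
    show ∀ x y K : ℝ, x * y * (K * K) = (x * K) * (y * K) from fun x y K => by ring, eUb, eUc]
  set M := (∑ η : BondConfig V, rcWeightW wX q ({u, u} : Set V) η * ind (Set.univ : Set (BondConfig V)) η) with hM
  set Yt := (∑ η : BondConfig V, rcWeightW wY q ({u, u} : Set V) η * ind {η : BondConfig V | b ∈ cl η.toFinset a ∧ c ∈ cl η.toFinset a} η) with hYt
  set Ys := (∑ η : BondConfig V, rcWeightW wY q ({u, u} : Set V) η * ind {η : BondConfig V | b ∉ cl η.toFinset a ∧ c ∉ cl η.toFinset a ∧ Sep DY (cl η.toFinset a) b c} η) with hYs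
  set Yb := (∑ η : BondConfig V, rcWeightW wY q ({u, u} : Set V) η * ind {η : BondConfig V | b ∈ cl η.toFinset a ∧ c ∉ cl η.toFinset a} η) with hYb
  set Yc := (∑ η : BondConfig V, rcWeightW wY q ({u, u} : Set V) η * ind {η : BondConfig V | b ∉ cl η.toFinset a ∧ c ∈ cl η.toFinset a} η) with hYc
  have hZY2 : 0 < rcPartitionFunctionW wY q ∅ * rcPartitionFunctionW wY q ∅ := mul_pos hZY hZY
  have ρ : Yt * Ys ≤ Yb * Yc := by
    rw [div_mul_div_comm, div_mul_div_comm, div_le_div_iff_of_pos_right hZY2] at hR1Y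
    exact hR1Y
  have hM0 : 0 ≤ M := hnn _ _
  calc M * Yt * (M * Ys) = (M * M) * (Yt * Ys) := by ring
    _ ≤ (M * M) * (Yb * Yc) := mul_le_mul_of_nonneg_left ρ (mul_nonneg hM0 hM0)
    _ = M * Yb * (M * Yc) := by ring

end Main

end OneSumFree

end Summit.CriticalPhenomena.PercolationContinuityZ3.Theorems
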